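import Literature.NumberTheory.Automorphic.ClozelAlgebraicityGLOneProofs
import Literature.NumberTheory.Automorphic.ReciprocityGLnRankOneProofs
import Literature.NumberTheory.Automorphic.GLOneArchParameterOfAlgebraicCharacter
import Literature.NumberTheory.GaloisRepresentations.AlgebraicHeckeCharacterNormValues
import Literature.FieldTheory.AlgClosed.AutComplexFiniteIndex
import Literature.NumberTheory.NumberFields.TotallyRealOrCM
import HarnessLib

/-!
# Clozel's algebraicity theorem for `GL₁`: the case `n = 1` of `Clozel1990_regularAlgebraic`, proved

Topic `NumberTheory/Automorphic`; proof file (theorems only: no definition, no named fact, no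
instance). The named fact `Clozel1990_regularAlgebraic` (`ClozelAlgebraicity`; Clozel 1990,
Thm. 3.13 with Lemme 4.9; Patrikis 2019, Thm. 3.2.1 and Cor. 3.2.3) asserts, for every `n`, every
number field `K` and every cuspidal regular algebraic `π` on `GL_n(𝔸_K)`: (i) `ℚ(π_f)` is a number
field; (ii) the `Aut(ℂ)`-conjugates `^σπ` exist, with the conjugate infinity type; (iii)
archimedean purity; (iv) `ℚ(π_f)` is totally real or CM. For `n = 1` this is Weil's theory of
Hecke characters of type `A₀` (Clozel 1990, §1: "pour `n = 1` … le théorème est dû à Weil";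
Weil 1956) and this file PROVES it, unconditionally, in the vocabulary of the fact:

* `clozel1990_regularAlgebraic_one` — **clauses (i)–(iv) for every cuspidal regular algebraic
  automorphic representation of `GL₁(𝔸_K)`** (Borel–Jacquet datum `π = W / W'`).

The proof assembles the tree's rank-one dictionary with Weil's theorems:
`π` has a Hecke character `θ` (`AutomorphicRepData.exists_heckeCharacter_glOne`) which is
algebraic of some infinity type `(p, q)` since `π` is C-algebraic
(`exists_hasInfinityType_heckeCharacter_glOne`, `ReciprocityGLnRankOneProofs`); conversely every
infinity type of `π` has `a`-multisets `{-n_ι}`, `n_ι = embExponent p q ι`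
(`map_a_eq_of_hasInfinityType_heckeCharacter_glOne`, `GLOneArchParameterOfAlgebraicCharacter`).
(ii): `π' = ℂ·(^σθ ∘ det)/⊥` with Weil's conjugate `^σθ` (`HeckeCharacter.HasInfinityType.autConj`,
`HeckeCharacterAutConj`) is cuspidal (no parabolic condition in rank one), is the `σ`-conjugate of
`π` at almost all places (`(^σθ)(ϖ_v) = σ(θ(ϖ_v))`), and has the infinity type `^σ` of that of `π`
(`n^σ_ι = n_{σ⁻¹ι}`). (iii): Weil's purity `n_ι + n_ῑ = w`
(`AlgebraicHeckeCharacterPurity`). (i): the values `θ(ϖ_v)` off a module of definition lie in a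
number field `E` (Weil; `HeckeCharacterValueFieldProofs`), `Aut(ℂ/E)` fixes the unramified Hecke
eigenvalues `t_{v,1} = θ(ϖ_v)`, `t_{v,0} = 1`, so `Aut(ℂ/E) ≤ Stab` and `ℚ(π_f) = Fix(Stab)` is
finite over `ℚ` (`Complex.finiteDimensional_fixedField_of_finiteIndex`). (iv): `ℚ(π_f) ⊆ ℚ(θ(ϖ_v) : v)`
and each `t = θ(ϖ_v)` satisfies `σ(t̄) = \overline{σ t}` for all `σ ∈ Aut(ℂ)` because
`|t|² = |σ t|² = Nv^w` (`norm_valueAtUniformizer_sq` of `AlgebraicHeckeCharacterNormValues` for `θ`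
and `^σθ`, which have the same weight),
so `ℚ(π_f)` is totally real or CM (`Subfield.isTotallyReal_or_isCMField_of_conj_comm`, Patrikis
Cor. 3.2.3's Galois-theory step).

## References

* L. Clozel, *Motifs et formes automorphes: applications du principe de fonctorialité*, in
  Automorphic forms, Shimura varieties, and L-functions I (Ann Arbor 1988), Academic Press 1990,
  §1, Thm. 3.13, Lemme 4.9. [Clozel1990]
* A. Weil, *On a certain type of characters of the idèle-class group of an algebraic
  number-field* (1956). [Weil1956]
* S. Patrikis, *Variations on a theorem of Tate*, Mem. AMS 258 (2019) = arXiv:1207.6724, §2.1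
  (Lemmas 2.1.1–2.1.3), Thm. 3.2.1, Cor. 3.2.3. [Patrikis2019]
* A. Borel, H. Jacquet, Corvallis 1979, Part 1, §4.4–4.6. [BorelJacquet1979]
-/

noncomputable section

open scoped Classical NumberField ComplexConjugate Cardinal
open NumberField IsDedekindDomain NumberField.InfinitePlace

namespace Literature.NumberTheory.Automorphic

open Literature.NumberTheory.GaloisRepresentations Literature.FieldTheory.AlgClosed

variable {K : Type} [Field K] [NumberField K] {hcpt : isCompact_glFiniteIntegralLevel 1 K}

/-! ### §1. The Borel–Jacquet line of a Hecke character is a cuspidal datum with that character -/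

/-- **In rank one every automorphic form is a cusp form**: there is no `k` with `0 < k < 1`, so the
parabolic condition of `IsCuspFormGL` is empty (Borel–Jacquet 1979, 4.4). [cite: BorelJacquet1979, 4.4] -/
theorem isCuspFormGL_one_iff {φ : (AdelicGroupData.gl 1 K).Adelic → ℂ} :
    IsCuspFormGL 1 K hcpt φ ↔ IsAutomorphicForm (AutomorphyDatum.gl 1 K hcpt) φ :=
  ⟨fun h ↦ h.1, fun h ↦ ⟨h, fun k hk hk1 ↦ absurd hk1 (by omega)⟩⟩

/-- The line `ℂ · (θ ∘ det)` consists of cusp forms on `GL₁`. [cite: BorelJacquet1979, 4.4–4.6] -/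
theorem span_detTwist_le_cuspFormsGL (hcpt : isCompact_glFiniteIntegralLevel 1 K) (θ : HeckeCharacter K) :
    Submodule.span ℂ {fun g : (AdelicGroupData.gl 1 K).Adelic ↦ (detTwist 1 θ g : ℂ)} ≤
      cuspFormsGL 1 K hcpt :=
  Submodule.span_mono (Set.singleton_subset_iff.mpr
    (isCuspFormGL_one_iff.mpr (isAutomorphicForm_detTwist_glOne hcpt θ)))

/-- **The cuspidal automorphic representation `π_θ = ℂ·(θ∘det)/⊥` of `GL₁(𝔸_K)` attached to a
Hecke character** (Borel–Jacquet model; `exists_automorphicRepData_detTwist_glOne` and rank-one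
cuspidality). Gelbart 1975, §2.A; Borel–Jacquet 1979, 4.6. [cite: BorelJacquet1979, 4.6] -/
theorem exists_cuspidal_detTwist_glOne (hcpt : isCompact_glFiniteIntegralLevel 1 K) (θ : HeckeCharacter K) :
    ∃ π : CuspidalAutomorphicRepData 1 K hcpt,
      π.1.W = Submodule.span ℂ {fun g : (AdelicGroupData.gl 1 K).Adelic ↦ (detTwist 1 θ g : ℂ)} ∧
        π.1.W' = ⊥ := by
  obtain ⟨π, hW, hW'⟩ := exists_automorphicRepData_detTwist_glOne hcpt θ
  have hle : π.W ≤ cuspFormsGL 1 K hcpt := by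
    rw [hW]
    exact span_detTwist_le_cuspFormsGL hcpt θ
  exact ⟨⟨π, hle⟩, hW, hW'⟩

/-- **`θ` is the Hecke character of `π_θ`**: every `g` acts on `ℂ·(θ∘det)` by `θ(det g)`
(`rightTranslation_detTwist_glOne`). [cite: BorelJacquet1979, 4.6] -/
theorem heckeCharacter_detTwist_glOne {θ : HeckeCharacter K}
    {π : AutomorphicRepData (AutomorphyDatum.gl 1 K hcpt)}
    (hW : π.W = Submodule.span ℂ {fun g : (AdelicGroupData.gl 1 K).Adelic ↦ (detTwist 1 θ g : ℂ)}) :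
    ∀ (g : (AdelicGroupData.gl 1 K).Adelic), ∀ φ ∈ π.W,
      rightTranslation (AdelicGroupData.gl 1 K) g φ -
        ((θ (Matrix.GeneralLinearGroup.det g) : ℂˣ) : ℂ) • φ ∈ π.W' := by
  intro g φ hφ
  rw [hW, Submodule.mem_span_singleton] at hφ
  obtain ⟨c, rfl⟩ := hφ
  rw [map_smul, rightTranslation_detTwist_glOne, detTwist_apply, smul_comm, sub_self]
  exact π.W'.zero_mem

/-! ### §2. Complex conjugation and `Aut(ℂ)` on numbers of prescribed absolute value -/

/-- If `|t|² = R = |σ t|²` for a real `R` fixed by the automorphism `σ` of `ℂ` (and `t ≠ 0`), then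
`σ(t̄) = \overline{σ t}`: both are `R / σ(t)`. [folklore] -/
theorem ringEquiv_conj_eq_conj_of_norm_sq_eq {σ : ℂ ≃+* ℂ} {t : ℂ} {R : ℝ} (ht0 : t ≠ 0)
    (ht : ‖t‖ ^ 2 = R) (hs : ‖σ t‖ ^ 2 = R) (hR : σ (R : ℂ) = R) :
    σ (conj t) = conj (σ t) := by
  have hst0 : σ t ≠ 0 := (map_ne_zero σ).mpr ht0
  have h1 : conj t = (R : ℂ) / t := by
    rw [eq_div_iff ht0, mul_comm, Complex.mul_conj, Complex.normSq_eq_norm_sq, ht]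
  have h2 : conj (σ t) = (R : ℂ) / σ t := by
    rw [eq_div_iff hst0, mul_comm, Complex.mul_conj, Complex.normSq_eq_norm_sq, hs]
  rw [h1, h2, map_div₀, hR]

/-! ### §3. The theorem -/

/-- **Clozel's algebraicity theorem (Clozel 1990, Thm. 3.13 and Lemme 4.9; Patrikis 2019,
Thm. 3.2.1 and Cor. 3.2.3) for `n = 1`, proved — the case `n = 1` of the named fact
`Clozel1990_regularAlgebraic`, which "is due to Weil" (Clozel 1990, §1; Weil 1956).** For every
number field `K` and every cuspidal regular algebraic automorphic representation `π` of `GL₁(𝔸_K)`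
(Borel–Jacquet datum): (i) the rationality field `ℚ(π_f) = ratField π` is finite over `ℚ`;
(ii) for every `σ ∈ Aut(ℂ)` there is a cuspidal `π'` on `GL₁(𝔸_K)` which is the `σ`-conjugate of
`π` at almost all places and whose infinity types have the `a`-multisets of `^σT` for every
regular algebraic infinity type `T` of `π`; (iii) archimedean purity of every such `T`; (iv)
`ℚ(π_f)` is totally real or CM. See the module docstring for the assembly (Hecke character `θ` of
`π`, Weil's `^σθ`, purity and value field of algebraic Hecke characters).
[cite: Clozel1990, Thm. 3.13 and Lemme 4.9 (n = 1)] [cite: Weil1956] [cite: Patrikis2019, Thm. 3.2.1, Cor. 3.2.3 (arXiv numbering)] -/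
theorem clozel1990_regularAlgebraic_one (hcpt : isCompact_glFiniteIntegralLevel 1 K)
    (π : CuspidalAutomorphicRepData 1 K hcpt) (hπ : π.1.IsRegularAlgebraic) :
    FiniteDimensional ℚ (ratField π.1) ∧
    (∀ σ : ℂ ≃ₐ[ℚ] ℂ, ∃ π' : CuspidalAutomorphicRepData 1 K hcpt,
      IsAutConjugate σ π.1 π'.1 ∧
      ∀ T : InfinityType K 1, π.1.HasInfinityType T → T.IsRegularAlgebraic →
        ∃ T' : InfinityType K 1, π'.1.HasInfinityType T' ∧
          ∀ ι : K →+* ℂ, (T' ι).map ArchWeight.a = (T.autConj σ ι).map ArchWeight.a) ∧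
    (∀ T : InfinityType K 1, π.1.HasInfinityType T → T.IsRegularAlgebraic →
      ∃ w : ℤ, ∀ ι : K →+* ℂ, (T ((starRingEnd ℂ).comp ι)).map ArchWeight.a =
        ((T ι).map ArchWeight.a).map fun a => (w : ℂ) - a) ∧
    (IsTotallyReal (ratField π.1) ∨ IsCMField (ratField π.1)) := by
  classical
  -- the Hecke character `θ` of `π`, algebraic of infinity type `(p, q)`, with a module of definition
  obtain ⟨θ, hθ⟩ := π.1.exists_heckeCharacter_glOne
  obtain ⟨T₀, hT₀, hreg₀⟩ := hπ
  obtain ⟨p, q, hpq⟩ := π.1.exists_hasInfinityType_heckeCharacter_glOne hθ hT₀ hreg₀.1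
  obtain ⟨Tm, e, hmod⟩ := θ.exists_isModulus
  obtain ⟨wt, hwt⟩ := hpq.exists_embExponent_add_conjugate_eq
  have hwt' := HeckeCharacter.two_mul_add_eq_weight_mul_mult_of_embExponent hwt
  -- every infinity type of `π` has `a`-multisets `{-n_ι}`
  have hTa : ∀ {T : InfinityType K 1}, π.1.HasInfinityType T → ∀ ι : K →+* ℂ,
      (T ι).map ArchWeight.a = {-((HeckeCharacter.embExponent p q ι : ℤ) : ℂ)} :=
    fun hT ι ↦ π.1.map_a_eq_of_hasInfinityType_heckeCharacter_glOne hθ hpq hT ι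
  -- unramified local data: `θ` is unramified off `Tm`, and the Satake parameters of `π` there
  have hunr : ∀ {v : HeightOneSpectrum (𝓞 K)}, v ∉ Tm → θ.IsUnramifiedAt v :=
    fun hv ↦ HeckeCharacter.isUnramifiedAt_of_isModulus' hmod hv
  have hloc : ∀ {v : HeightOneSpectrum (𝓞 K)}, v ∉ Tm → ∀ {ϖ : (v.adicCompletion K)ˣ},
      Valued.v (ϖ : v.adicCompletion K) = WithZero.exp (-1 : ℤ) →
        ((θ (localUnits v ϖ) : ℂˣ) : ℂ) = θ.valueAtUniformizer v := by
    intro v hv ϖ hϖ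
    rw [(hunr hv).coe_map_localUnits_eq_zpow ϖ (m := 1) hϖ, zpow_one]
  -- the values `t_v = θ(ϖ_v)`, `v ∉ Tm`, generate a number field `E₁`
  obtain ⟨E, hEfin, hEmem⟩ := hpq.exists_intermediateField_valueAtUniformizer_mem_of_not_mem hmod
  haveI := hEfin
  set S : Set ℂ := {z | ∃ v : HeightOneSpectrum (𝓞 K), v ∉ Tm ∧ z = θ.valueAtUniformizer v}
    with hSdef
  set E₁ : IntermediateField ℚ ℂ := IntermediateField.adjoin ℚ S with hE₁def
  have hSE₁ : S ⊆ E₁ := IntermediateField.subset_adjoin ℚ S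
  have hE₁E : E₁ ≤ E := IntermediateField.adjoin_le_iff.mpr (by
    rintro _ ⟨v, hv, rfl⟩
    exact hEmem v hv)
  haveI hE₁fin : FiniteDimensional ℚ E₁ :=
    Module.Finite.of_injective (IntermediateField.inclusion hE₁E).toLinearMap
      (IntermediateField.inclusion_injective hE₁E)
  -- `Aut(ℂ/E₁)` fixes the unramified Hecke eigenvalues of `π` at every `v ∉ Tm`
  have hstab : E₁.fixingSubgroup ≤ heckeStabilizer π.1 := by
    intro σ hσ
    rw [mem_heckeStabilizer_iff]
    have hfin : ({v : HeightOneSpectrum (𝓞 K) | v ∈ Tm} : Set _).Finite := Tm.finite_toSet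
    filter_upwards [hfin.compl_mem_cofinite] with v hv α hα i hi
    simp only [Set.mem_compl_iff, Set.mem_setOf_eq] at hv
    obtain ⟨ϖ, hϖ, rfl⟩ := π.1.exists_eq_singleton_of_hasSatakeParamAt_glOne hθ hα
    have hfix : σ (θ.valueAtUniformizer v) = θ.valueAtUniformizer v :=
      (IntermediateField.mem_fixingSubgroup_iff E₁ σ).mp hσ _ (hSE₁ ⟨v, hv, rfl⟩)
    rw [hloc hv hϖ, ← heckeEigenvalueOf_one_singleton_map σ v _ hi, hfix]
  -- `ℚ(π_f) ⊆ E₁`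
  have hrat : ∀ z ∈ ratField π.1, z ∈ E₁ := fun z hz ↦
    Complex.mem_of_forall_mem_fixingSubgroup E₁ fun σ hσ ↦ (mem_ratField_iff π.1 z).mp hz σ (hstab hσ)
  refine ⟨?_, fun σ ↦ ?_, fun T hT _ ↦ ?_, ?_⟩
  · /- (i) `ℚ(π_f)` is a number field: `Aut(ℂ/E₁) ≤ Stab`, so `Fix(Stab)` is finite over `ℚ`
      (`Complex.finiteDimensional_fixedField_of_finiteIndex` with index `1`). -/
    have hfi : ((heckeStabilizer π.1 ⊓ E₁.fixingSubgroup).subgroupOf E₁.fixingSubgroup).FiniteIndex := by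
      rw [inf_eq_right.mpr hstab, Subgroup.subgroupOf_self]
      infer_instance
    exact Complex.finiteDimensional_fixedField_of_finiteIndex (heckeStabilizer π.1) E₁ hfi
  · /- (ii) the conjugate `π' = π_{^σθ}`. -/
    obtain ⟨π', hW, hW'⟩ := exists_cuspidal_detTwist_glOne hcpt (hpq.autConj σ)
    have hθ' := heckeCharacter_detTwist_glOne (hcpt := hcpt) hW
    refine ⟨π', ?_, fun T hT _ ↦ ?_⟩
    · -- `σ`-conjugate at almost all places: `v ∉ Tm` and `v ∤ 𝔪'`, a level of `^σθ`
      obtain ⟨𝔪', h𝔪', hθ𝔪'⟩ := (hpq.autConj σ).exists_level_glOne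
      have hfin : ({v : HeightOneSpectrum (𝓞 K) | v ∈ Tm ∨ v.asIdeal ∣ 𝔪'} : Set _).Finite :=
        Tm.finite_toSet.union (Ideal.finite_factors h𝔪')
      have hev := π.1.eventually_hasSatakeParamAt_glOne hθ
      change ∀ᶠ v : HeightOneSpectrum (𝓞 K) in Filter.cofinite, _
      filter_upwards [hfin.compl_mem_cofinite, hev] with v hv hsat
      simp only [Set.mem_compl_iff, Set.mem_setOf_eq, not_or] at hv
      have hϖv := HeckeCharacter.valued_uniformizer (K := K) v
      refine ⟨{((θ (localUnits v (HeckeCharacter.uniformizer K v)) : ℂˣ) : ℂ)},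
        {(((hpq.autConj σ) (localUnits v (HeckeCharacter.uniformizer K v)) : ℂˣ) : ℂ)},
        hsat _ hϖv,
        AutomorphicRepData.hasSatakeParamAt_detTwist_glOne hcpt hW hW' h𝔪' hθ𝔪' v hv.2 hϖv,
        fun i hi ↦ ?_⟩
      rw [hpq.autConj_apply_of_fst_eq_one σ (localUnits_fst v _)]
      exact heckeEigenvalueOf_one_singleton_map σ v _ hi
    · -- the infinity type of `π'` is `^σ` of that of `π`: `n^σ_ι = n_{σ⁻¹ ι}`
      obtain ⟨T', hT', hT'a⟩ :=
        π'.1.exists_hasInfinityType_of_hasInfinityType_heckeCharacter_glOne hθ'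
          (hpq.hasInfinityType_autConj σ)
      refine ⟨T', hT', fun ι ↦ ?_⟩
      rw [hT'a ι, InfinityType.autConj_apply, hTa hT, HeckeCharacter.embExponent_autConjType]
  · /- (iii) purity: `-n_ῑ = -w - (-n_ι)` with `n_ι + n_ῑ = w`. -/
    refine ⟨-wt, fun ι ↦ ?_⟩
    have hconj : (starRingEnd ℂ).comp ι = ComplexEmbedding.conjugate ι := RingHom.ext fun _ ↦ rfl
    rw [hconj, hTa hT, hTa hT, Multiset.map_singleton]
    congr 1
    have h := hwt ι
    have h' : ((HeckeCharacter.embExponent p q (ComplexEmbedding.conjugate ι) : ℤ) : ℂ) =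
        wt - HeckeCharacter.embExponent p q ι := by
      rw [← h]
      push_cast
      ring
    rw [h']
    push_cast
    ring
  · /- (iv) `ℚ(π_f)` is totally real or CM: on `ℚ(π_f) ⊆ ℚ(t_v : v ∉ Tm)` complex conjugation
      commutes with `Aut(ℂ)`, since `|t_v|² = |σ t_v|² = Nv^w`. -/
    have hfd : FiniteDimensional ℚ (ratField π.1) := by
      have hfi : ((heckeStabilizer π.1 ⊓ E₁.fixingSubgroup).subgroupOf E₁.fixingSubgroup).FiniteIndex := by
        rw [inf_eq_right.mpr hstab, Subgroup.subgroupOf_self]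
        infer_instance
      exact Complex.finiteDimensional_fixedField_of_finiteIndex (heckeStabilizer π.1) E₁ hfi
    -- `σ(t̄) = \overline{σ t}` on the generators `t = θ(ϖ_v)`
    have hS : ∀ σ : ℂ ≃+* ℂ, ∀ z ∈ S, σ (conj z) = conj (σ z) := by
      rintro σ _ ⟨v, hv, rfl⟩
      let σ' : ℂ ≃ₐ[ℚ] ℂ := AlgEquiv.ofRingEquiv (f := σ) fun x ↦ by simp
      -- `^σθ`: same weight, unramified at `v`
      obtain ⟨e', hmod'⟩ := (hpq.autConj σ').exists_isModulus_of_ramified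
      have hv' : v ∉ (HeckeCharacter.finite_ramifiedPlaces_holds (hpq.autConj σ')).toFinset := by
        rw [Set.Finite.mem_toFinset]
        exact fun h ↦ h ((hpq.isUnramifiedAt_autConj_iff σ' v).mpr (hunr hv))
      have hwσ := HeckeCharacter.two_mul_add_eq_weight_mul_mult_of_embExponent
        (hpq.embExponent_autConjType_add_conjugate_eq σ' hwt)
      have hns : ‖σ (θ.valueAtUniformizer v)‖ ^ 2 = ((Ideal.absNorm v.asIdeal : ℝ)) ^ wt := by
        have h := (hpq.hasInfinityType_autConj σ').norm_valueAtUniformizer_sq hmod' hwσ hv'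
        rw [hpq.valueAtUniformizer_autConj] at h
        exact h
      have hnt : ‖θ.valueAtUniformizer v‖ ^ 2 = ((Ideal.absNorm v.asIdeal : ℝ)) ^ wt :=
        hpq.norm_valueAtUniformizer_sq hmod hwt' hv
      refine ringEquiv_conj_eq_conj_of_norm_sq_eq (HeckeCharacter.valueAtUniformizer_ne_zero' θ v)
        hnt hns ?_
      push_cast
      rw [map_zpow₀, map_natCast]
    -- hence on `E₁ = ℚ(S) ⊇ ℚ(π_f)`
    have hcomm : ∀ σ : ℂ ≃+* ℂ, ∀ z ∈ (ratField π.1).toSubfield, σ (conj z) = conj (σ z) := by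
      intro σ z hz
      have hzE₁ : z ∈ E₁ := hrat z hz
      let Fσ : Subfield ℂ :=
        RingHom.eqLocusField (σ.toRingHom.comp (starRingEnd ℂ)) ((starRingEnd ℂ).comp σ.toRingHom)
      have hFσ : ∀ x : ℚ, algebraMap ℚ ℂ x ∈ Fσ := fun x ↦ by
        change σ (conj (algebraMap ℚ ℂ x)) = conj (σ (algebraMap ℚ ℂ x))
        simp
      have hle : E₁ ≤ Fσ.toIntermediateField hFσ :=
        IntermediateField.adjoin_le_iff.mpr fun z hz ↦ hS σ z hz
      exact hle hzE₁
    exact Literature.NumberTheory.NumberFields.Subfield.isTotallyReal_or_isCMField_of_conj_comm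
      (ratField π.1).toSubfield hcomm

end Literature.NumberTheory.Automorphic
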